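import Mathlib
import HarnessLib
import Summits.ValiantsHypothesis.ValiantsHypothesis.Theorems.LacunarySymmetroidMatrixDescartesOsculationLawGPWitnessGeneric

/-!
# ValiantsHypothesis / LacunarySymmetroid — crux `MatrixDescartes` (stmt-ValiantsHypothesis-18050, V1),
# line «osculation-law», `stub_recursion` ROUTE′ density: the generic diagonal witness on the LINE'S SLOT TYPE
# `Fin m ⊕ Fin 0`

`OsculationGeneric.exists_generic_diagonal_witness'` (✓ `…GPWitnessGeneric`, the ROUTE′ density witness of record,
desk RULING #287) produces the witness entries `σ : Fin K → Fin m → ℝ`; the recursion files of ROUTE′ (p4 g13's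
`node_certificates`, val-port-3 g1's density frame `GPDensity.mem_closure_nodeFamilyPrime`) index the slots by the
line's block type `Fin m ⊕ Fin 0`.  This file is the reindexing corollary, nothing more:
`exists_generic_diagonal_witness_sum` — entries `σ : Fin K → (Fin m ⊕ Fin 0) → ℝ`, all positive, distinct within
every letter, off any finite family `extra` of nonzero polynomials (evaluated at the `Fin K × Fin m` uncurrying), and at
every level `2 ≤ j ≤ K` the diagonal product over `Fin m ⊕ Fin 0` of the level fewnomials
`Σ_{l<j} C(σ (castLE hj l) i) · X^{d (castLE hj l)}` has full degree `m·d_{j−1}` and is SEPARABLE (so each slot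
fewnomial is separable and distinct slots are coprime, `separable_and_isCoprime_of_prod`).

Honest framing: bookkeeping for the witness side of an UNREGISTERED density residue of a V1 law line;
`stub_recursion`, the LAW `stub_osculationLaw`, `MatrixDescartes`, Conjecture B and `VP ≠ VNP` are OPEN / NOT proved.
No definitions, no named facts.
-/

-- `Summit.ValiantsHypothesis.ValiantsHypothesis.…` is the tree's mandated single-conjunct layout (Sub = Summit).
set_option linter.dupNamespace false

noncomputable section

namespace Summit.ValiantsHypothesis.ValiantsHypothesis.Theorems.LacunarySymmetroidMatrixDescartes

namespace OsculationGeneric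

open Polynomial
open scoped BigOperators

/-- A product over `Fin m ⊕ Fin 0` is the product over `Fin m` of the `inl` slots. [folklore] -/
theorem prod_sum_fin_zero {M : Type*} [CommMonoid M] {m : ℕ} (f : Fin m ⊕ Fin 0 → M) :
    ∏ i : Fin m ⊕ Fin 0, f i = ∏ i : Fin m, f (Sum.inl i) := by
  rw [Fintype.prod_sum_type]
  simp

/-- **Generic diagonal witness on the slot type `Fin m ⊕ Fin 0`.**  See the module docstring. [folklore] -/
theorem exists_generic_diagonal_witness_sum (m K : ℕ) (d : Fin K → ℕ) (hd : StrictMono d)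
    (hd0 : ∀ h : 0 < K, d ⟨0, h⟩ = 0) (extra : Finset (MvPolynomial (Fin K × Fin m) ℝ))
    (hextra : ∀ Q ∈ extra, Q ≠ 0) :
    ∃ σ : Fin K → (Fin m ⊕ Fin 0) → ℝ, (∀ l i, 0 < σ l i) ∧
      (∀ Q ∈ extra, MvPolynomial.eval (fun p : Fin K × Fin m => σ p.1 (Sum.inl p.2)) Q ≠ 0) ∧
      (∀ l i j, i ≠ j → σ l i ≠ σ l j) ∧
      ∀ (j : ℕ) (hj : j ≤ K) (hj2 : 2 ≤ j),
        (∏ i : Fin m ⊕ Fin 0, ∑ l : Fin j, C (σ (Fin.castLE hj l) i) * (X : ℝ[X]) ^ d (Fin.castLE hj l)).natDegree =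
            m * d (Fin.castLE hj ⟨j - 1, by omega⟩) ∧
        (∏ i : Fin m ⊕ Fin 0, ∑ l : Fin j, C (σ (Fin.castLE hj l) i) * (X : ℝ[X]) ^ d (Fin.castLE hj l)).Separable := by
  obtain ⟨σ, hpos, hex, hrow, hlev⟩ := exists_generic_diagonal_witness' m K d hd hd0 extra hextra
  refine ⟨fun l i => σ l (Sum.elim id Fin.elim0 i), fun l i => hpos _ _, ?_, ?_, ?_⟩
  · simpa using hex
  · rintro l (i | i) (j | j) hij
    · exact hrow l i j (fun h => hij (by rw [h]))
    · exact Fin.elim0 j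
    · exact Fin.elim0 i
    · exact Fin.elim0 i
  · intro j hj hj2
    rw [prod_sum_fin_zero]
    simpa using hlev j hj hj2

end OsculationGeneric

end Summit.ValiantsHypothesis.ValiantsHypothesis.Theorems.LacunarySymmetroidMatrixDescartes
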